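import Mathlib
import HarnessLib
import Literature.AlgebraicGeometry.Crystalline.BlochEsnaultKerzLifting
import Literature.AlgebraicGeometry.Motives.Differentials

/-!
# Sketch — first lemmas of three crux ideas for `FormalLiftingFromClassLifting`
(crux item stmt-HodgeConjecture-13825, route PadicSemiregularLift; planner crux-ideate, round 1, ideator 3).

All statements are over the crux's own carriers (`WittScheme.thickening`, `KTheory.KZero`,
`WittScheme.LiftsToThickening / LiftsFormally / LiftsTo`). They are NOT proved here; this file only
certifies that the first checkable statement of each line elaborates.
-/

open CategoryTheory Limits AlgebraicGeometry
open Literature.AlgebraicGeometry.Motives Literature.AlgebraicGeometry.KTheory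
open Literature.AlgebraicGeometry.Motives.WittScheme Literature.AlgebraicGeometry.Crystalline

noncomputable section

namespace Summit.HodgeConjecture.HodgeConjecture.Cruxes.FormalLiftingFromClassLifting.IdeatorThree

universe u

variable {p : ℕ} [Fact p.Prime] {k : Type} [Field k] [CharP k p] [PerfectRing k p]

/-- The standing hypotheses of the crux on `𝒳/W(k)`: smooth proper model of relative dimension `d`,
projective over `W`, `d + 6 < p`, `p`-torsion-free `H^b(𝒳, 𝒪)` and `H^b(𝒳, Ω¹)`, and
`d ≤ 3 ∨ Ω¹ free` (verbatim the binders of `FormalLiftingFromClassLifting`). -/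
def CruxHypotheses (d : ℕ) (𝒳 : SchemeOver (WittVector p k)) : Prop :=
  IsSmoothProperModel d 𝒳 ∧ IsProjectiveOverRing 𝒳 ∧ d + 6 < p ∧
    (∀ (b : ℕ) (x : structureSheafCohomology 𝒳.left b), (p : ℤ) • x = 0 → x = 0) ∧
    (∀ (b : ℕ) (x : hodgeCohomologyOne 𝒳 b), (p : ℤ) • x = 0 → x = 0) ∧
    (d ≤ 3 ∨ Nonempty (cotangentSheaf 𝒳 ≅ SheafOfModules.free (R := 𝒳.left.ringCatSheaf) (Fin d)))

/-! ## Idea 1 (staircase-bockstein): first lemma = level-wise kernel lifting `(2_K)` -/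

/-- **(2_K) KernelLiftsOneStep.** Under the crux hypotheses, every class in
`ker(K₀(X_{n+1}) → K₀(X_k))` is the restriction of a class on `X_{n+2}`; equivalently
`Ob_{n+2}(η)` depends only on `η|_{X_k}`. Idea 1 proves this by identifying the one-step relative
syntomic complexes of the tower with the "staircase" subquotients
`[p^{n(i-j)}Ω^j_𝒳 / p^{(n+1)(i-j)}Ω^j_𝒳, d]_{j<i}` of the de Rham complex (AMMN Thm F(2) + DGM),
so that every obstruction is a Bockstein of `RΓ(𝒳, Ω^j)` or a Hodge-to-de Rham differential. -/
def KernelLiftsOneStep : Prop :=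
  ∀ (d : ℕ) (𝒳 : SchemeOver (WittVector p k)), CruxHypotheses d 𝒳 →
    ∀ (n : ℕ) (η : KZero (thickening 𝒳 (n + 1)).left),
      KZero.map (specialFibreToThickening 𝒳 n) η = 0 →
        ∃ y : KZero (thickening 𝒳 (n + 2)).left,
          KZero.map (thickeningMap 𝒳 (Nat.le_succ (n + 1))) y = η

/-- The relative form actually delivered by the staircase calculus, `(REL-SURJ)`: for all
`m + 1 ≤ n + 1`, classes on `X_{n+1}` dying on `X_{m+1}` lift to `X_{n+2}` (the case `m = 0` is
`KernelLiftsOneStep`, since `X_1 ≅ X_k`). -/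
def TowerKernelsLift : Prop :=
  ∀ (d : ℕ) (𝒳 : SchemeOver (WittVector p k)), CruxHypotheses d 𝒳 →
    ∀ (m n : ℕ) (h : m + 1 ≤ n + 1) (η : KZero (thickening 𝒳 (n + 1)).left),
      KZero.map (thickeningMap 𝒳 h) η = 0 →
        ∃ y : KZero (thickening 𝒳 (n + 2)).left,
          KZero.map (thickeningMap 𝒳 (Nat.le_succ (n + 1))) y = η

/-! ## Idea 2 (crystalline-rigidity): first lemma = liftability is decided on the special fibre -/

/-- **LiftabilityDecidedOnSpecialFibre.** Whether a class on `X_{n+1}` extends to `X_{n+2}` depends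
only on its restriction to `X_k` (crystalline Chern classes of `η` and of `η|_{X_k}` agree in
`H_cris(X_k/W_{n+2}) = H_dR(X_{n+2}/W_{n+2})`, and the finite-level lifting criterion says `η`
extends iff that class is Hodge at level `n+2`). -/
def LiftabilityDecidedOnSpecialFibre : Prop :=
  ∀ (d : ℕ) (𝒳 : SchemeOver (WittVector p k)), CruxHypotheses d 𝒳 →
    ∀ (n : ℕ) (η η' : KZero (thickening 𝒳 (n + 1)).left),
      KZero.map (specialFibreToThickening 𝒳 n) η = KZero.map (specialFibreToThickening 𝒳 n) η' →
        ((∃ y : KZero (thickening 𝒳 (n + 2)).left,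
            KZero.map (thickeningMap 𝒳 (Nat.le_succ (n + 1))) y = η) ↔
          ∃ y : KZero (thickening 𝒳 (n + 2)).left,
            KZero.map (thickeningMap 𝒳 (Nat.le_succ (n + 1))) y = η')

/-- **(1_K) ClassLiftsToEveryLevel**, the second consequence of the finite-level criterion: a class
`[E₁]` whose rational image lifts to `(lim K₀(X_n)) ⊗ ℚ` lifts INTEGRALLY to every `K₀(X_{n+1})`
(torsion classes included: the pro-obstruction is additive into the torsion-free
`H^{2r}(𝒳, p(r)Ω^{<r})`). -/
def ClassLiftsToEveryLevel : Prop :=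
  ∀ (d : ℕ) (𝒳 : SchemeOver (WittVector p k)), CruxHypotheses d 𝒳 →
    ∀ (E₁ : (specialFibre 𝒳).left.Modules) (hE₁ : IsFiniteLocallyFree E₁),
      (∃ ξ : ContinuousKZeroRat (Ideal.span {(p : WittVector p k)}) 𝒳,
        KZeroRat.map (specialFibreToTower 𝒳)
          (ContinuousKZeroRat.specialFibre (Ideal.span {(p : WittVector p k)}) 𝒳 ξ) =
            KZeroRat.of E₁ hE₁) →
      ∀ n : ℕ, ∃ y : KZero (thickening 𝒳 (n + 1)).left,
        KZero.map (specialFibreToThickening 𝒳 n) y = KZero.of E₁ hE₁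

/-! ## Idea 3 (greenberg-decoupling): first lemma = level-wise lifts already give an algebraic lift -/

/-- **GreenbergDecoupling.** On a projective smooth model, a vector bundle on the special fibre that
lifts to EVERY thickening separately (no compatibility asked) lifts to `𝒳` itself — hence formally.
Uniform presentations `𝒪(-m₁)^a → 𝒪(-m₀)^b → F → 0` (Serre vanishing, bounds depending on `E₁`
only) put all lifts inside one finite-type `W`-scheme of matrices with locally free cokernel, and
Greenberg's approximation theorem gives a `W`-point. -/
def GreenbergDecoupling : Prop :=
  ∀ (d : ℕ) (𝒳 : SchemeOver (WittVector p k)), IsSmoothProperModel d 𝒳 → IsProjectiveOverRing 𝒳 →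
    ∀ (E₁ : (specialFibre 𝒳).left.Modules), IsFiniteLocallyFree E₁ →
      (∀ n : ℕ, LiftsToThickening 𝒳 E₁ n) → LiftsTo 𝒳 E₁

/-- The formal corollary used by Idea 3's induction (restrict an algebraic lift to the tower). -/
def LevelwiseLiftsSuffice : Prop :=
  ∀ (d : ℕ) (𝒳 : SchemeOver (WittVector p k)), IsSmoothProperModel d 𝒳 → IsProjectiveOverRing 𝒳 →
    ∀ (E₁ : (specialFibre 𝒳).left.Modules), IsFiniteLocallyFree E₁ →
      (∀ n : ℕ, LiftsToThickening 𝒳 E₁ n) → LiftsFormally 𝒳 E₁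

/-- Sanity: `KernelLiftsOneStep` is the `m = 0` instance shape of `TowerKernelsLift` once one knows
`specialFibreToThickening 𝒳 n ≫ _ ` factors the restriction to `X_1`; recorded only as a remark. -/
example : True := trivial

end Summit.HodgeConjecture.HodgeConjecture.Cruxes.FormalLiftingFromClassLifting.IdeatorThree

end
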